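import Summits.ValiantsHypothesis.ValiantsHypothesis.Theorems.KPlusLogSqLawTridiagonalRealStaticWronskian

/-!
# Route «KPlusLogSqLaw», crux `WeakLifting` (stmt-ValiantsHypothesis-19561) — REAL side of the tridiagonal sector:
# the Christoffel–Darboux identity for GENERAL (monomial) links — virtual vertex exponents, the signed sum of squares at a root,
# and the ROOT-TYPE (creation / annihilation) criterion of the α register

HONEST FRAMING.  Helper (`--supports stmt-ValiantsHypothesis-19561 --as helper`), seat val-sym-lift-p2 (g15), cell `pub-symmetroid`,
2026-08-28; α register (static definite symmetric tridiagonal row `B m`), UPPER / structure side.  A KERNEL TOOL plus two one-type laws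
on a cone; NO count law for the register.  The companion file `…TridiagonalRealStaticWronskian` (val-sym-lift-p2 g11) proved the one-edge
recursion `X_mul_wronskian_step` for all designs and the closed Christoffel–Darboux form only for CONSTANT links (`f ≡ 0`, the vertex gauge).
THIS FILE closes the form for ARBITRARY natural link exponents `f`, in the tree's continuant currency `D_k = pathDet a d b f k`
(`D₀ = 1`, `D₁ = a₀X^{d₀}`, `D_{n+2} = a_{n+1}X^{d_{n+1}}D_{n+1} − (b_nX^{f_n})²D_n`):

* `X_mul_wronskian_eq_sum_links` (ALL static symmetric tridiagonal designs, all `k`): for every ALTERNATING ANTIDERIVATIVE `G : ℕ → ℤ` of the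
  doubled link exponents (`G 0 = 0`, `G (j+1) = 2 f_j − G j`, i.e. `G_j = 2(f_{j−1} − f_{j−2} + … ± f_0)`),
  `X·Wr(D_{k+1}, D_k) = G_k·D_k·D_{k+1} + Σ_{j ≤ k} a_j (d_j − G_j) · X^{d_j} · (∏_{j ≤ i < k} (b_i X^{f_i})²) · D_j²`.
  The numbers `ε_j := d_j − G_j` are the VIRTUAL VERTEX EXPONENTS of the design (the diagonal exponents it would have after the diagonal
  monomial congruence that makes all links constant — which the natural-exponent currency cannot always write down); the cross term
  `G_k D_k D_{k+1}` is the price of staying in natural exponents and VANISHES AT EVERY ROOT of `D_{k+1}`.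
* `X_mul_derivative_mul_eval_of_root` (ALL designs): at a root `x` of `D_{k+1}`,
  `x · D_{k+1}′(x) · D_k(x) = Σ_{j ≤ k} (∏ (b_i x^{f_i})²) · a_j ε_j · x^{d_j} · D_j(x)²` — a SIGNED SUM OF SQUARES.  READING (Sturm/Jacobi, for
  the cell's particle picture of the register): the sign of `D_{k+1}′D_k` at a simple positive root decides whether the number of sign changes of
  `(D_0, …, D_{k+1})` — the negative inertia index of the leading `(k+2) × (k+2)` block — goes UP (a «creation», `D′_{k+1}D_k < 0`) or DOWN (an
  «annihilation», `> 0`) as `x` increases; so every annihilation needs a vertex with `ε_j < 0` whose square dominates, every creation one with `ε_j > 0`.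
* ONE-TYPE LAWS ON THE GAUGE CONE (`0 < a_j`, links `b_i ≠ 0`, `x > 0`): `derivative_mul_prev_pos_of_cone` — if `ε_j ≥ 0` for all `j ≤ k` and `d_0 > 0`
  then `D_{k+1}′(x) D_k(x) > 0` at every positive root of `D_{k+1}` (all roots are annihilations in the orientation above; equivalently all creations
  for `x ↦ 1/x`); `derivative_mul_prev_neg_of_anticone` — if `ε_j ≤ 0` for all `j ≤ k` and `ε_1 < 0` then `D_{k+1}′(x) D_k(x) < 0` at every positive root.
  The cone `{ε_j ≥ 0 ∀ j}` is exactly the class that a diagonal monomial congruence carries to val-sym-lift-p2 g10's Loewner-monotone vertex gauge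
  (`…MonotonePencilInertia.card_posRoots_vertexGauge_le_half`, `Z ≤ ⌊m/2⌋`); the laws here are the continuant-side face of that monotonicity and are
  NOT new counts.  They are sharp as SLOPE conditions: the tree's `4 × 4` witness `exists_static_definite_tridiagonal_four_three` (links `2X, 3X³, 2X`,
  constant diagonal; `ε = (0, −2, 4, −2)`, mixed signs) has roots of both types and three positive zeros `> ⌊4/2⌋`.
* `strictMonoOn_gauge_ratio` / `atMostOne_root_next_of_cone`: on the cone (with `d_0 > 0`) the GAUGED RATIO `x^{−G_k} · D_{k+1}(x)/D_k(x)` is strictly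
  increasing on every window `[u, v] ⊂ (0, ∞)` free of zeros of `D_k`, hence `D_{k+1}` has at most one zero per such window — g11's appendix
  (`atMostOne_root_next`, `f ≡ 0`) extended from constant links to the whole cone.

LOCATED CONTEXT (seat diagnostics, exact rationals; NOT claims of this file): along `x`, the kernel extremal designs of the register keep the Sturm
count of `(D_0..D_m)` inside `{1, 2}` («breathing»): the `B 5 = 7` design has `Z(D_0..D_5) = (0,0,1,0,0,7)` and the `B 7 ≥ 11` design
`(0,0,1,1,1,0,2,11)`, all zeros of `D_m` being alternate creations/annihilations at the last site with `min(N⁺, N⁻) = m − 2`; the signed sum of squares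
above is the exact quantity whose sign alternates along those zeros.  Nothing here bears on `WeakLifting` / `TropicalB` (stmt-19771) in their windows,
on Conjecture B, on the Door-A registers, on `MatrixDescartes` (stmt-ValiantsHypothesis-18050) or on VP ≠ VNP.
[folklore: Christoffel–Darboux / Sturm for three-term recurrences; bookkeeping of this seat]
-/

set_option linter.dupNamespace false
set_option autoImplicit false

namespace Summit.ValiantsHypothesis.ValiantsHypothesis.Theorems.KPlusLogSqLaw

namespace StaticTridiagonalRealPotential

open Polynomial Finset

variable (a : ℕ → ℝ) (d : ℕ → ℕ) (b : ℕ → ℝ) (f : ℕ → ℕ)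

/-! ## 1. The Christoffel–Darboux identity with general links -/

/-- **Christoffel–Darboux for general links.**  For every alternating antiderivative `G` of the doubled link exponents
(`G 0 = 0`, `G (j+1) = 2 f_j − G j`) and every `k`:
`X·(D_{k+1}′ D_k − D_{k+1} D_k′) = G_k · D_k D_{k+1} + Σ_{j ≤ k} a_j (d_j − G_j) X^{d_j} (∏_{j ≤ i < k} (b_i X^{f_i})²) D_j²`.
For `f ≡ 0` (`G ≡ 0`) this is `X_mul_wronskian_eq_sum`. [folklore: Christoffel–Darboux; bookkeeping of this seat] -/
theorem X_mul_wronskian_eq_sum_links (G : ℕ → ℤ) (hG0 : G 0 = 0) (hG : ∀ j, G (j + 1) = 2 * (f j : ℤ) - G j) (k : ℕ) :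
    (X : ℝ[X]) * (derivative (pathDet a d b f (k + 1)) * pathDet a d b f k
        - pathDet a d b f (k + 1) * derivative (pathDet a d b f k)) =
      C ((G k : ℝ)) * pathDet a d b f k * pathDet a d b f (k + 1) +
      ∑ j ∈ range (k + 1), C (a j * ((d j : ℝ) - (G j : ℝ))) * X ^ d j *
        (∏ i ∈ Ico j k, (C (b i) * X ^ f i) ^ 2) * pathDet a d b f j ^ 2 := by
  induction k with
  | zero =>
    rw [sum_range_one]
    simp only [pathDet_one, pathDet_zero, hG0, Int.cast_zero, map_zero, zero_mul, zero_add, sub_zero,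
      derivative_one, mul_zero, mul_one, Ico_self, prod_empty, one_pow]
    exact X_mul_derivative_monomial _ _
  | succ n ih =>
    have hstep := X_mul_wronskian_step a d b f n
    have hrec : pathDet a d b f (n + 2) =
        (C (a (n + 1)) * X ^ d (n + 1)) * pathDet a d b f (n + 1) - (C (b n) * X ^ f n) ^ 2 * pathDet a d b f n :=
      pathDet_add_two a d b f n
    have hB2 : (C (b n) * (X : ℝ[X]) ^ f n) ^ 2 = C (b n ^ 2) * X ^ (2 * f n) := by
      rw [mul_pow, ← map_pow, ← pow_mul, mul_comm (f n) 2]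
    have hGr : ((G (n + 1) : ℤ) : ℝ) = 2 * (f n : ℝ) - ((G n : ℤ) : ℝ) := by exact_mod_cast hG n
    -- split off the new top term of the sum and factor the last link out of the old terms
    have hR : (∑ j ∈ range (n + 1 + 1), C (a j * ((d j : ℝ) - (G j : ℝ))) * X ^ d j *
          (∏ i ∈ Ico j (n + 1), (C (b i) * X ^ f i) ^ 2) * pathDet a d b f j ^ 2) =
        (∑ j ∈ range (n + 1), C (a j * ((d j : ℝ) - (G j : ℝ))) * X ^ d j *
          (∏ i ∈ Ico j (n + 1), (C (b i) * X ^ f i) ^ 2) * pathDet a d b f j ^ 2) +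
          C (a (n + 1) * ((d (n + 1) : ℝ) - (G (n + 1) : ℝ))) * X ^ d (n + 1) * pathDet a d b f (n + 1) ^ 2 := by
      rw [Finset.sum_range_succ, Ico_self, prod_empty, mul_one]
    have hT : ∀ j ∈ range (n + 1), C (a j * ((d j : ℝ) - (G j : ℝ))) * X ^ d j *
          (∏ i ∈ Ico j (n + 1), (C (b i) * X ^ f i) ^ 2) * pathDet a d b f j ^ 2 =
        (C (b n) * X ^ f n) ^ 2 * (C (a j * ((d j : ℝ) - (G j : ℝ))) * X ^ d j *
          (∏ i ∈ Ico j n, (C (b i) * X ^ f i) ^ 2) * pathDet a d b f j ^ 2) := by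
      intro j hj
      have hjn : j ≤ n := Nat.lt_succ_iff.mp (mem_range.mp hj)
      rw [Finset.prod_Ico_succ_top hjn]
      ring
    rw [show n + 1 + 1 = n + 2 from rfl] at hR ⊢
    rw [hR, Finset.sum_congr rfl hT, ← Finset.mul_sum]
    -- the old sum is `X·Wr_{n+1} − G_n D_n D_{n+1}` by the induction hypothesis
    have ih' : (∑ j ∈ range (n + 1), C (a j * ((d j : ℝ) - (G j : ℝ))) * X ^ d j *
          (∏ i ∈ Ico j n, (C (b i) * X ^ f i) ^ 2) * pathDet a d b f j ^ 2) =
        (X : ℝ[X]) * (derivative (pathDet a d b f (n + 1)) * pathDet a d b f n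
          - pathDet a d b f (n + 1) * derivative (pathDet a d b f n)) -
          C ((G n : ℝ)) * pathDet a d b f n * pathDet a d b f (n + 1) := by
      rw [ih]; ring
    rw [ih']
    -- coefficient identities as polynomial constants
    have hC1 : C (((G (n + 1) : ℤ) : ℝ)) = C (2 * (f n : ℝ)) - C (((G n : ℤ) : ℝ)) := by
      rw [hGr, map_sub]
    have hC2 : C (a (n + 1) * ((d (n + 1) : ℝ) - ((G (n + 1) : ℤ) : ℝ))) =
        C (a (n + 1) * (d (n + 1) : ℝ)) - C (a (n + 1)) * C (((G (n + 1) : ℤ) : ℝ)) := by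
      rw [← map_mul, ← map_sub]; congr 1; ring
    have hC3 : C (2 * (f n : ℝ) * b n ^ 2) = C (2 * (f n : ℝ)) * C (b n ^ 2) := by rw [← map_mul]
    rw [hstep, hC2, hC3, hB2, hrec, hC1]
    simp only [map_pow, map_mul]
    ring

/-! ## 2. Evaluation: the signed sum of squares at a root -/

/-- Real-point form of `X_mul_wronskian_eq_sum_links`. [bookkeeping] -/
theorem x_mul_wronskian_eval_links (G : ℕ → ℤ) (hG0 : G 0 = 0) (hG : ∀ j, G (j + 1) = 2 * (f j : ℤ) - G j) (k : ℕ) (x : ℝ) :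
    x * ((derivative (pathDet a d b f (k + 1))).eval x * (pathDet a d b f k).eval x
        - (pathDet a d b f (k + 1)).eval x * (derivative (pathDet a d b f k)).eval x) =
      (G k : ℝ) * (pathDet a d b f k).eval x * (pathDet a d b f (k + 1)).eval x +
      ∑ j ∈ range (k + 1), (a j * ((d j : ℝ) - (G j : ℝ))) * x ^ d j *
        (∏ i ∈ Ico j k, (b i * x ^ f i) ^ 2) * ((pathDet a d b f j).eval x) ^ 2 := by
  have h := congrArg (fun p : ℝ[X] => p.eval x) (X_mul_wronskian_eq_sum_links a d b f G hG0 hG k)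
  simp only [eval_mul, eval_X, eval_sub, eval_add, eval_C, eval_finsetSum, eval_pow, eval_prod] at h
  exact h

/-- **The signed sum of squares at a root.**  If `D_{k+1}(x) = 0` then
`x · D_{k+1}′(x) · D_k(x) = Σ_{j ≤ k} a_j ε_j x^{d_j} (∏_{j ≤ i < k} (b_i x^{f_i})²) D_j(x)²` with the virtual vertex exponents `ε_j = d_j − G_j`.
[bookkeeping of this seat] -/
theorem x_mul_derivative_mul_eval_of_root (G : ℕ → ℤ) (hG0 : G 0 = 0) (hG : ∀ j, G (j + 1) = 2 * (f j : ℤ) - G j) (k : ℕ)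
    {x : ℝ} (hroot : (pathDet a d b f (k + 1)).eval x = 0) :
    x * ((derivative (pathDet a d b f (k + 1))).eval x * (pathDet a d b f k).eval x) =
      ∑ j ∈ range (k + 1), (a j * ((d j : ℝ) - (G j : ℝ))) * x ^ d j *
        (∏ i ∈ Ico j k, (b i * x ^ f i) ^ 2) * ((pathDet a d b f j).eval x) ^ 2 := by
  have h := x_mul_wronskian_eval_links a d b f G hG0 hG k x
  rw [hroot] at h
  simpa using h

/-! ## 3. One-type laws on the gauge cone -/

/-- **Cone law (all roots of one type).**  Positive diagonal coefficients, nonzero links, `d_0 > 0` and nonnegative virtual vertex exponents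
`G_j ≤ d_j` (`j ≤ k`): at every positive root `x` of `D_{k+1}` one has `D_{k+1}′(x) · D_k(x) > 0`.  (The `j = 0` square is
`(∏ b_i² x^{2f_i}) a_0 d_0 x^{d_0} > 0`, every other term is `≥ 0`.) [bookkeeping of this seat; folklore: Sturm] -/
theorem derivative_mul_prev_pos_of_cone (G : ℕ → ℤ) (hG0 : G 0 = 0) (hG : ∀ j, G (j + 1) = 2 * (f j : ℤ) - G j) (k : ℕ)
    (ha : ∀ t, 0 < a t) (hb : ∀ t, b t ≠ 0) (hd : 0 < d 0) (hcone : ∀ j, j ≤ k → (G j : ℝ) ≤ d j)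
    {x : ℝ} (hx : 0 < x) (hroot : (pathDet a d b f (k + 1)).eval x = 0) :
    0 < (derivative (pathDet a d b f (k + 1))).eval x * (pathDet a d b f k).eval x := by
  have h := x_mul_derivative_mul_eval_of_root a d b f G hG0 hG k hroot
  have hterm : ∀ j ∈ range (k + 1), 0 ≤ (a j * ((d j : ℝ) - (G j : ℝ))) * x ^ d j *
      (∏ i ∈ Ico j k, (b i * x ^ f i) ^ 2) * ((pathDet a d b f j).eval x) ^ 2 := by
    intro j hj
    have hjk : j ≤ k := Nat.lt_succ_iff.mp (mem_range.mp hj)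
    have h1 : 0 ≤ a j * ((d j : ℝ) - (G j : ℝ)) := mul_nonneg (ha j).le (sub_nonneg.mpr (hcone j hjk))
    exact mul_nonneg (mul_nonneg (mul_nonneg h1 (pow_nonneg hx.le _)) (prod_nonneg fun i _ => sq_nonneg _)) (sq_nonneg _)
  have h0 : 0 < (a 0 * ((d 0 : ℝ) - (G 0 : ℝ))) * x ^ d 0 *
      (∏ i ∈ Ico 0 k, (b i * x ^ f i) ^ 2) * ((pathDet a d b f 0).eval x) ^ 2 := by
    rw [pathDet_zero, eval_one, one_pow, mul_one, hG0, Int.cast_zero, sub_zero]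
    have h1 : 0 < a 0 * (d 0 : ℝ) := mul_pos (ha 0) (Nat.cast_pos.mpr hd)
    have h2 : 0 < ∏ i ∈ Ico 0 k, (b i * x ^ f i) ^ 2 :=
      prod_pos fun i _ => pow_pos (abs_pos.mpr (mul_ne_zero (hb i) (pow_ne_zero _ hx.ne'))) 2 |>.trans_eq (sq_abs _)
    exact mul_pos (mul_pos h1 (pow_pos hx _)) h2
  have hsum : 0 < ∑ j ∈ range (k + 1), (a j * ((d j : ℝ) - (G j : ℝ))) * x ^ d j *
      (∏ i ∈ Ico j k, (b i * x ^ f i) ^ 2) * ((pathDet a d b f j).eval x) ^ 2 :=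
    lt_of_lt_of_le h0 (single_le_sum (f := fun j => (a j * ((d j : ℝ) - (G j : ℝ))) * x ^ d j *
      (∏ i ∈ Ico j k, (b i * x ^ f i) ^ 2) * ((pathDet a d b f j).eval x) ^ 2) hterm (mem_range.mpr (Nat.succ_pos k)))
  rw [← h] at hsum
  exact (mul_pos_iff_of_pos_left hx).mp hsum

/-- **Anticone law (all roots of the other type).**  Positive diagonal coefficients, nonzero links, nonpositive virtual vertex exponents
`d_j ≤ G_j` (`j ≤ k`, so `d_0 = 0`) with `d_1 < G_1 = 2 f_0`, and `k ≥ 1`: at every positive root `x` of `D_{k+1}`, `D_{k+1}′(x) · D_k(x) < 0`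
(the `j = 1` square `a_1 (d_1 − 2f_0) x^{d_1} (∏ …) D_1(x)²` is `< 0` since `D_1(x) = a_0 x^{d_0} ≠ 0`). [bookkeeping of this seat; folklore: Sturm] -/
theorem derivative_mul_prev_neg_of_anticone (G : ℕ → ℤ) (hG0 : G 0 = 0) (hG : ∀ j, G (j + 1) = 2 * (f j : ℤ) - G j) (k : ℕ)
    (hk : 1 ≤ k) (ha : ∀ t, 0 < a t) (hb : ∀ t, b t ≠ 0) (hanti : ∀ j, j ≤ k → (d j : ℝ) ≤ G j) (hstrict : (d 1 : ℝ) < G 1)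
    {x : ℝ} (hx : 0 < x) (hroot : (pathDet a d b f (k + 1)).eval x = 0) :
    (derivative (pathDet a d b f (k + 1))).eval x * (pathDet a d b f k).eval x < 0 := by
  have h := x_mul_derivative_mul_eval_of_root a d b f G hG0 hG k hroot
  have hterm : ∀ j ∈ range (k + 1), (a j * ((d j : ℝ) - (G j : ℝ))) * x ^ d j *
      (∏ i ∈ Ico j k, (b i * x ^ f i) ^ 2) * ((pathDet a d b f j).eval x) ^ 2 ≤ 0 := by
    intro j hj
    have hjk : j ≤ k := Nat.lt_succ_iff.mp (mem_range.mp hj)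
    have h1 : a j * ((d j : ℝ) - (G j : ℝ)) ≤ 0 := mul_nonpos_of_nonneg_of_nonpos (ha j).le (sub_nonpos.mpr (hanti j hjk))
    exact mul_nonpos_of_nonpos_of_nonneg (mul_nonpos_of_nonpos_of_nonneg
      (mul_nonpos_of_nonpos_of_nonneg h1 (pow_nonneg hx.le _)) (prod_nonneg fun i _ => sq_nonneg _)) (sq_nonneg _)
  have hD1 : (pathDet a d b f 1).eval x ≠ 0 := by
    rw [pathDet_one, eval_mul, eval_C, eval_pow, eval_X]
    exact mul_ne_zero (ha 0).ne' (pow_ne_zero _ hx.ne')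
  have h1 : (a 1 * ((d 1 : ℝ) - (G 1 : ℝ))) * x ^ d 1 *
      (∏ i ∈ Ico 1 k, (b i * x ^ f i) ^ 2) * ((pathDet a d b f 1).eval x) ^ 2 < 0 := by
    have e1 : a 1 * ((d 1 : ℝ) - (G 1 : ℝ)) < 0 := mul_neg_of_pos_of_neg (ha 1) (sub_neg.mpr hstrict)
    have e2 : 0 < ∏ i ∈ Ico 1 k, (b i * x ^ f i) ^ 2 :=
      prod_pos fun i _ => pow_pos (abs_pos.mpr (mul_ne_zero (hb i) (pow_ne_zero _ hx.ne'))) 2 |>.trans_eq (sq_abs _)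
    have e3 : 0 < ((pathDet a d b f 1).eval x) ^ 2 := pow_pos (abs_pos.mpr hD1) 2 |>.trans_eq (sq_abs _)
    exact mul_neg_of_neg_of_pos (mul_neg_of_neg_of_pos (mul_neg_of_neg_of_pos e1 (pow_pos hx _)) e2) e3
  have hsum : ∑ j ∈ range (k + 1), (a j * ((d j : ℝ) - (G j : ℝ))) * x ^ d j *
      (∏ i ∈ Ico j k, (b i * x ^ f i) ^ 2) * ((pathDet a d b f j).eval x) ^ 2 < 0 := by
    have hmem : (1 : ℕ) ∈ range (k + 1) := mem_range.mpr (by omega)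
    rw [← Finset.add_sum_erase _ _ hmem]
    have hrest : ∑ j ∈ (range (k + 1)).erase 1, (a j * ((d j : ℝ) - (G j : ℝ))) * x ^ d j *
        (∏ i ∈ Ico j k, (b i * x ^ f i) ^ 2) * ((pathDet a d b f j).eval x) ^ 2 ≤ 0 :=
      sum_nonpos fun j hj => hterm j (mem_of_mem_erase hj)
    linarith
  rw [← h] at hsum
  exact neg_of_mul_neg_right hsum hx.le

/-! ## 4. The gauged ratio is monotone on the cone: at most one root per window -/

/-- **The gauged ratio `x^{−G_k} · D_{k+1}(x) / D_k(x)` is strictly increasing** on every `[u, v] ⊂ (0, ∞)` free of zeros of `D_k`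
(cone: `G_j ≤ d_j` for `j ≤ k`, `0 < a_j`, nonzero links, `0 < d_0`): its derivative is `x^{−G_k − 1} · (signed sum of squares) / D_k(x)² > 0`.
For `f ≡ 0` (`G ≡ 0`) this is `strictMonoOn_ratio`. [folklore: Sturm; bookkeeping of this seat] -/
theorem strictMonoOn_gauge_ratio (G : ℕ → ℤ) (hG0 : G 0 = 0) (hG : ∀ j, G (j + 1) = 2 * (f j : ℤ) - G j) (k : ℕ)
    (ha : ∀ t, 0 < a t) (hb : ∀ t, b t ≠ 0) (hd : 0 < d 0) (hcone : ∀ j, j ≤ k → (G j : ℝ) ≤ d j)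
    {u v : ℝ} (hu : 0 < u) (hk : ∀ x ∈ Set.Icc u v, (pathDet a d b f k).eval x ≠ 0) :
    StrictMonoOn (fun x => x ^ (-(G k)) * ((pathDet a d b f (k + 1)).eval x / (pathDet a d b f k).eval x)) (Set.Icc u v) := by
  set P := pathDet a d b f (k + 1) with hP
  set Q := pathDet a d b f k with hQ
  -- the derivative of the gauged ratio
  have hderiv : ∀ x ∈ Set.Icc u v, HasDerivAt (fun y => y ^ (-(G k)) * (P.eval y / Q.eval y))
      (((-(G k) : ℤ) : ℝ) * x ^ (-(G k) - 1) * (P.eval x / Q.eval x) +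
        x ^ (-(G k)) * (((derivative P).eval x * Q.eval x - P.eval x * (derivative Q).eval x) / (Q.eval x) ^ 2)) x := by
    intro x hx
    have hx0 : x ≠ 0 := (hu.trans_le hx.1).ne'
    exact (hasDerivAt_zpow (-(G k)) x (Or.inl hx0)).mul ((P.hasDerivAt x).div (Q.hasDerivAt x) (hk x hx))
  refine strictMonoOn_of_deriv_pos (convex_Icc u v) ?_ ?_
  · exact fun x hx => (hderiv x hx).continuousAt.continuousWithinAt
  · intro x hx
    rw [interior_Icc] at hx
    have hx' : x ∈ Set.Icc u v := Set.Ioo_subset_Icc_self hx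
    rw [(hderiv x hx').deriv]
    have hxpos : 0 < x := hu.trans hx.1
    have hQx : Q.eval x ≠ 0 := hk x hx'
    -- the signed sum of squares is positive on the cone
    have hS := x_mul_wronskian_eval_links a d b f G hG0 hG k x
    have hterm : ∀ j ∈ range (k + 1), 0 ≤ (a j * ((d j : ℝ) - (G j : ℝ))) * x ^ d j *
        (∏ i ∈ Ico j k, (b i * x ^ f i) ^ 2) * ((pathDet a d b f j).eval x) ^ 2 := by
      intro j hj
      have hjk : j ≤ k := Nat.lt_succ_iff.mp (mem_range.mp hj)
      have h1 : 0 ≤ a j * ((d j : ℝ) - (G j : ℝ)) := mul_nonneg (ha j).le (sub_nonneg.mpr (hcone j hjk))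
      exact mul_nonneg (mul_nonneg (mul_nonneg h1 (pow_nonneg hxpos.le _)) (prod_nonneg fun i _ => sq_nonneg _)) (sq_nonneg _)
    have h0 : 0 < (a 0 * ((d 0 : ℝ) - (G 0 : ℝ))) * x ^ d 0 *
        (∏ i ∈ Ico 0 k, (b i * x ^ f i) ^ 2) * ((pathDet a d b f 0).eval x) ^ 2 := by
      rw [pathDet_zero, eval_one, one_pow, mul_one, hG0, Int.cast_zero, sub_zero]
      have h1 : 0 < a 0 * (d 0 : ℝ) := mul_pos (ha 0) (Nat.cast_pos.mpr hd)
      have h2 : 0 < ∏ i ∈ Ico 0 k, (b i * x ^ f i) ^ 2 :=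
        prod_pos fun i _ => pow_pos (abs_pos.mpr (mul_ne_zero (hb i) (pow_ne_zero _ hxpos.ne'))) 2 |>.trans_eq (sq_abs _)
      exact mul_pos (mul_pos h1 (pow_pos hxpos _)) h2
    have hsum : 0 < ∑ j ∈ range (k + 1), (a j * ((d j : ℝ) - (G j : ℝ))) * x ^ d j *
        (∏ i ∈ Ico j k, (b i * x ^ f i) ^ 2) * ((pathDet a d b f j).eval x) ^ 2 :=
      lt_of_lt_of_le h0 (single_le_sum (f := fun j => (a j * ((d j : ℝ) - (G j : ℝ))) * x ^ d j *
        (∏ i ∈ Ico j k, (b i * x ^ f i) ^ 2) * ((pathDet a d b f j).eval x) ^ 2) hterm (mem_range.mpr (Nat.succ_pos k)))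
    -- `S(x) := x·Wr(x) − G_k Q(x) P(x) > 0`
    have hSpos : 0 < x * ((derivative P).eval x * Q.eval x - P.eval x * (derivative Q).eval x) -
        (G k : ℝ) * Q.eval x * P.eval x := by
      rw [hP, hQ, hS]; linarith
    -- rewrite the derivative as `x^{−G_k − 1} · S(x) / Q(x)²`
    have hx1 : x ^ (-(G k)) = x ^ (-(G k) - 1) * x := by
      rw [← zpow_add_one₀ hxpos.ne', sub_add_cancel]
    have key : ((-(G k) : ℤ) : ℝ) * x ^ (-(G k) - 1) * (P.eval x / Q.eval x) +
        x ^ (-(G k)) * (((derivative P).eval x * Q.eval x - P.eval x * (derivative Q).eval x) / (Q.eval x) ^ 2) =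
        x ^ (-(G k) - 1) * ((x * ((derivative P).eval x * Q.eval x - P.eval x * (derivative Q).eval x) -
          (G k : ℝ) * Q.eval x * P.eval x) / (Q.eval x) ^ 2) := by
      rw [hx1]
      field_simp
      push_cast
      ring
    rw [key]
    exact mul_pos (zpow_pos hxpos _) (div_pos hSpos (pow_pos (abs_pos.mpr hQx) 2 |>.trans_eq (sq_abs _)))

/-- **At most one root per window on the cone**: on any `[u, v] ⊂ (0, ∞)` free of zeros of `D_k`, the next continuant `D_{k+1}` has at most one zero
(cone hypotheses as in `strictMonoOn_gauge_ratio`).  For `f ≡ 0` this is g11's `atMostOne_root_next`. [folklore: Sturm] -/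
theorem atMostOne_root_next_of_cone (G : ℕ → ℤ) (hG0 : G 0 = 0) (hG : ∀ j, G (j + 1) = 2 * (f j : ℤ) - G j) (k : ℕ)
    (ha : ∀ t, 0 < a t) (hb : ∀ t, b t ≠ 0) (hd : 0 < d 0) (hcone : ∀ j, j ≤ k → (G j : ℝ) ≤ d j)
    {u v : ℝ} (hu : 0 < u) (hk : ∀ x ∈ Set.Icc u v, (pathDet a d b f k).eval x ≠ 0)
    {x₁ x₂ : ℝ} (h₁ : x₁ ∈ Set.Icc u v) (h₂ : x₂ ∈ Set.Icc u v)
    (r₁ : (pathDet a d b f (k + 1)).eval x₁ = 0) (r₂ : (pathDet a d b f (k + 1)).eval x₂ = 0) : x₁ = x₂ := by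
  have hmono := strictMonoOn_gauge_ratio a d b f G hG0 hG k ha hb hd hcone hu hk
  have e : (fun x => x ^ (-(G k)) * ((pathDet a d b f (k + 1)).eval x / (pathDet a d b f k).eval x)) x₁ =
      (fun x => x ^ (-(G k)) * ((pathDet a d b f (k + 1)).eval x / (pathDet a d b f k).eval x)) x₂ := by
    simp only [r₁, r₂, zero_div, mul_zero]
  exact hmono.injOn h₁ h₂ e

end StaticTridiagonalRealPotential

end Summit.ValiantsHypothesis.ValiantsHypothesis.Theorems.KPlusLogSqLaw
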